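import Summits.HodgeConjecture.CorCM.IrreducibleOddWeightsCoreTowerExact
import HarnessLib

/-!
# Core tower, VII: EXACTNESS AT EVERY LEVEL — whenever the Galois field of an absorbed level lies inside one of the two
# fields, additivity for ALL CM types holds iff its traces on the other field are real

COR-CM (cell `pub-hodgecm2`, binder seat `b16` gen 67, count-neutral claim CORE TOWER, file A7; theorems only, no
definition, no named fact, no `sorry`).  NEW as stated, hence under `Summits/`.  HONEST FRAMING: exact type-free criteria
for `Hg(A₀ × A₁) = Hg(A₀) × Hg(A₁)` (abelian varieties with complex multiplication by two CM fields); no Hodge class is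
claimed algebraic; `HC_CM` is neither used nor asserted.

SETTING (A1–A3).  CM fields `K_{i₀}, K_{i₁}`, embeddings `a`, `b`, Galois closures `L₀, L₁ ⊆ ℂ`; for a number field `T`,
`L_T = normalClosure ℚ T ℂ` and `F_κ^T` = the matrix coefficients of slot `κ` summed over the classes of embeddings agreeing
on the trace `a⁻¹(L_T)`; `T` is ABSORBED when `MC₀ ∩ MC₁ = F₀^T ∩ F₁^T` for every pair of types (A1/A2: `T = K_{i₀}`, then
the trace fields along the tower).

* §1 **THE NECESSARY CONDITION, no hypothesis** (`forall_conj_apply_eq_of_forall_cmFamilyRank_add_card_eq`): if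
  `Hg(A₀ × A₁) = Hg(A₀) × Hg(A₁)` for all CM types then complex conjugation fixes EVERY `a(K_{i₀}) ∩ b(K_{i₁})` pointwise
  (a non-real common element generates a common subfield with a CM type — A3).
* §2 **EXACTNESS TEMPLATE** (`forall_cmFamilyRank_add_card_eq_iff_of_absorbed_of_le_fieldRange{,'}`): if `T` is absorbed
  and `L_T ⊆ b₀(K_{i₁})` (resp. `⊆ a₀(K_{i₀})`), then additivity for ALL types **iff** the traces of `L_T` on `K_{i₀}`
  (resp. on `K_{i₁}`) are real along every embedding.  A3 is the level `L_T = E₁`; here every level qualifies.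
* §3 Instances: level two with ANY admissible `T₁` (`…_of_traces_le_of_le_fieldRange`), and **LEVEL THREE**
  (`…_of_traces_le_of_traces_le_of_le_fieldRange`): `T₁ ⊇` traces of `L₀` on `K_{i₁}`, `T₂ ⊇` traces of `L_{T₁}` on
  `K_{i₀}`, `L_{T₂} ⊆ a₀(K_{i₀})` ⟹ (additivity ∀ types ⟺ the traces of `L_{T₂}` on `K_{i₁}` are real).  So the
  «no common CM subfield» criterion is EXACT as soon as SOME level of the tower has a normal trace field (the lane's census,
  kit j235265/j235446, lists how often).

## References

* [Gordon1999HodgeAVSurvey] B. B. Gordon, *A survey of the Hodge conjecture for abelian varieties*, §3 Theorem (proof),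
  7.5–7.7, 7.6.1.
* [MoonenZarhin1999LowDim] B. Moonen, Yu. Zarhin, Math. Ann. 315 (1999), Thm. (0.2).
* [Lang2002] S. Lang, *Algebra*, 3rd ed., VI §1 Thm. 1.1, Cor. 1.6, Thm. 1.12 and V §2 Thm. 2.8.
* [Shimura1998] G. Shimura, *Abelian Varieties with Complex Multiplication and Modular Functions*, §8.3, §18.2, §32.9.
-/

set_option autoImplicit false

noncomputable section

open scoped BigOperators Classical
open NumberField Module IntermediateField

namespace Summit.HodgeConjecture.CorCM

open Literature.NumberTheory.ComplexMultiplication Literature.AlgebraicGeometry.Pohlmann1968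
open Literature.AlgebraicGeometry.Motives (CMType)

variable {I : Type} [Fintype I] {K : I → Type} [∀ i, Field (K i)] [∀ i, NumberField (K i)] [∀ i, IsCMField (K i)]
  {T : Type} [Field T] [NumberField T] {T' : Type} [Field T'] [NumberField T']

/-! ### §1 The necessary condition -/

omit [Field T] [NumberField T] [Field T'] [NumberField T'] in
/-- **IF `Hg(A₀ × A₁) = Hg(A₀) × Hg(A₁)` FOR ALL CM TYPES, THEN COMPLEX CONJUGATION FIXES EVERY `a(K_{i₀}) ∩ b(K_{i₁})`
POINTWISE** — for ANY two CM fields: a non-real common element `z = a k = b k'` makes `b⁻¹(a(K_{i₀}))` a common subfield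
with a CM type, whose induced pair interacts (A3 `exists_cmFamilyRank_add_card_lt_of_mem_of_le_fieldRange`).
[cite: Gordon1999HodgeAVSurvey, 7.5–7.7 and 7.6.1] [cite: Shimura1998, §18.2 and §32.9] -/
theorem forall_conj_apply_eq_of_forall_cmFamilyRank_add_card_eq {i₀ i₁ : I} (h01 : i₀ ≠ i₁)
    (hI : ∀ l, l = i₀ ∨ l = i₁)
    (hall : ∀ Φ : ∀ i, CMType (K i), CMAlgebra.cmFamilyRank Φ + Fintype.card I = (∑ i, cmTypeRank (Φ i)) + 1)
    (a : K i₀ →+* ℂ) (b : K i₁ →+* ℂ) (z : ℂ) (hz₀ : z ∈ a.toRatAlgHom.fieldRange)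
    (hz₁ : z ∈ b.toRatAlgHom.fieldRange) : starRingEnd ℂ z = z := by
  obtain ⟨k, rfl⟩ := AlgHom.mem_fieldRange.1 hz₀
  by_contra hne
  have hreal : k ∉ maximalRealSubfield (K i₀) := fun hmem =>
    hne ((conj_apply_eq_iff_mem_maximalRealSubfield a k).2 hmem)
  obtain ⟨Φ, hlt⟩ := exists_cmFamilyRank_add_card_lt_of_mem_of_le_fieldRange h01 hI a b
    b.toRatAlgHom.fieldRange le_rfl hz₁ hreal
  exact absurd (hall Φ) hlt.ne

/-! ### §2 The exactness template on an absorbed level -/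

omit [Field T'] [NumberField T'] in
/-- **EXACTNESS ON AN ABSORBED LEVEL, traces on `K_{i₀}`.**  If `T` is absorbed (`MC₀ ∩ MC₁ = F₀^T ∩ F₁^T` for every pair
of types) and `L_T ⊆ b₀(K_{i₁})`, then `Hg(A₀ × A₁) = Hg(A₀) × Hg(A₁)` for ALL CM types **iff conjugation fixes `a(K_{i₀}) ∩
L_T` pointwise for every `a`** (`⟸`: the classes on `K_{i₀}` are conjugation-stable, `F₀^T = 0`; `⟹`: §1's mechanism
inside `L_T ⊆ b₀(K_{i₁})`). [cite: Gordon1999HodgeAVSurvey, §3 Theorem (proof), 7.5–7.7 and 7.6.1]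
[cite: MoonenZarhin1999LowDim, Thm. (0.2)] -/
theorem forall_cmFamilyRank_add_card_eq_iff_of_absorbed_of_le_fieldRange {i₀ i₁ : I} (h01 : i₀ ≠ i₁)
    (hI : ∀ l, l = i₀ ∨ l = i₁) (b₀ : K i₁ →+* ℂ)
    (habs : ∀ Φ : ∀ i, CMType (K i),
      Submodule.span ℚ (Set.range fun x : K i₀ →+* ℂ => fun g : ℂ ≃+* ℂ => antiVec (Φ i₀).1 g x) ⊓
          Submodule.span ℚ (Set.range fun x : K i₁ →+* ℂ => fun g : ℂ ≃+* ℂ => antiVec (Φ i₁).1 g x) =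
        Submodule.span ℚ (Set.range fun a : K i₀ →+* ℂ => fun g : ℂ ≃+* ℂ =>
            ∑ t ∈ Finset.univ.filter
              (fun t : K i₀ →+* ℂ => ∃ n : ℂ ≃+* ℂ, (∀ y : T →+* ℂ, n • y = y) ∧ n • a = t), antiVec (Φ i₀).1 g t) ⊓
          Submodule.span ℚ (Set.range fun a : K i₁ →+* ℂ => fun g : ℂ ≃+* ℂ =>
            ∑ t ∈ Finset.univ.filter
              (fun t : K i₁ →+* ℂ => ∃ n : ℂ ≃+* ℂ, (∀ y : T →+* ℂ, n • y = y) ∧ n • a = t), antiVec (Φ i₁).1 g t))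
    (hgal : normalClosure ℚ T ℂ ≤ b₀.toRatAlgHom.fieldRange) :
    (∀ Φ : ∀ i, CMType (K i), CMAlgebra.cmFamilyRank Φ + Fintype.card I = (∑ i, cmTypeRank (Φ i)) + 1) ↔
      ∀ (a : K i₀ →+* ℂ) (k : K i₀), a k ∈ normalClosure ℚ T ℂ → starRingEnd ℂ (a k) = a k := by
  constructor
  · intro hall a k hk
    by_contra hne
    have hreal : k ∉ maximalRealSubfield (K i₀) := fun hmem =>
      hne ((conj_apply_eq_iff_mem_maximalRealSubfield a k).2 hmem)
    obtain ⟨Φ, hlt⟩ := exists_cmFamilyRank_add_card_lt_of_mem_of_le_fieldRange h01 hI a b₀ _ hgal hk hreal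
    exact absurd (hall Φ) hlt.ne
  · intro hreal Φ
    haveI : ∀ i, Nonempty (K i →+* ℂ) := fun i => inferInstance
    exact IrrOdd.typeRank_sigmaType_add_card_eq_of_absorbed_of_rho_stable (G := ℂ ≃+* ℂ) (E := fun i => K i →+* ℂ)
      (Φ := fun i => (Φ i).1) (fun i => isCMTypeWith_conj (Φ i)) hI h01 (W := T →+* ℂ) (habs Φ)
      fun a => exists_stabAux_smul_eq_conj_of_forall_conj_apply_eq a (hreal a)

omit [Field T'] [NumberField T'] in
/-- **EXACTNESS ON AN ABSORBED LEVEL, traces on `K_{i₁}`.**  `T` absorbed and `L_T ⊆ a₀(K_{i₀})` ⟹ additivity for ALL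
types iff conjugation fixes `b(K_{i₁}) ∩ L_T` pointwise for every `b`.
[cite: Gordon1999HodgeAVSurvey, §3 Theorem (proof), 7.5–7.7 and 7.6.1] [cite: MoonenZarhin1999LowDim, Thm. (0.2)] -/
theorem forall_cmFamilyRank_add_card_eq_iff_of_absorbed_of_le_fieldRange' {i₀ i₁ : I} (h01 : i₀ ≠ i₁)
    (hI : ∀ l, l = i₀ ∨ l = i₁) (a₀ : K i₀ →+* ℂ)
    (habs : ∀ Φ : ∀ i, CMType (K i),
      Submodule.span ℚ (Set.range fun x : K i₀ →+* ℂ => fun g : ℂ ≃+* ℂ => antiVec (Φ i₀).1 g x) ⊓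
          Submodule.span ℚ (Set.range fun x : K i₁ →+* ℂ => fun g : ℂ ≃+* ℂ => antiVec (Φ i₁).1 g x) =
        Submodule.span ℚ (Set.range fun a : K i₀ →+* ℂ => fun g : ℂ ≃+* ℂ =>
            ∑ t ∈ Finset.univ.filter
              (fun t : K i₀ →+* ℂ => ∃ n : ℂ ≃+* ℂ, (∀ y : T →+* ℂ, n • y = y) ∧ n • a = t), antiVec (Φ i₀).1 g t) ⊓
          Submodule.span ℚ (Set.range fun a : K i₁ →+* ℂ => fun g : ℂ ≃+* ℂ =>
            ∑ t ∈ Finset.univ.filter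
              (fun t : K i₁ →+* ℂ => ∃ n : ℂ ≃+* ℂ, (∀ y : T →+* ℂ, n • y = y) ∧ n • a = t), antiVec (Φ i₁).1 g t))
    (hgal : normalClosure ℚ T ℂ ≤ a₀.toRatAlgHom.fieldRange) :
    (∀ Φ : ∀ i, CMType (K i), CMAlgebra.cmFamilyRank Φ + Fintype.card I = (∑ i, cmTypeRank (Φ i)) + 1) ↔
      ∀ (b : K i₁ →+* ℂ) (k : K i₁), b k ∈ normalClosure ℚ T ℂ → starRingEnd ℂ (b k) = b k := by
  constructor
  · intro hall b k hk
    by_contra hne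
    have hreal : k ∉ maximalRealSubfield (K i₁) := fun hmem =>
      hne ((conj_apply_eq_iff_mem_maximalRealSubfield b k).2 hmem)
    obtain ⟨Φ, hlt⟩ := exists_cmFamilyRank_add_card_lt_of_mem_of_le_fieldRange h01.symm
      (fun l => (hI l).symm) b a₀ _ hgal hk hreal
    exact absurd (hall Φ) hlt.ne
  · intro hreal Φ
    haveI : ∀ i, Nonempty (K i →+* ℂ) := fun i => inferInstance
    exact IrrOdd.typeRank_sigmaType_add_card_eq_of_absorbed_of_rho_stable' (G := ℂ ≃+* ℂ) (E := fun i => K i →+* ℂ)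
      (Φ := fun i => (Φ i).1) (fun i => isCMTypeWith_conj (Φ i)) hI h01 (W := T →+* ℂ) (habs Φ)
      fun b => exists_stabAux_smul_eq_conj_of_forall_conj_apply_eq b (hreal b)

/-! ### §3 Levels two and three -/

omit [Field T'] [NumberField T'] in
/-- **LEVEL TWO, any admissible `T₁`**: `b(K_{i₁}) ∩ L₀ ⊆ L_{T₁}` for every `b` and `L_{T₁} ⊆ b₀(K_{i₁})` ⟹ additivity for
ALL types iff conjugation fixes every `a(K_{i₀}) ∩ L_{T₁}` (A3 had the canonical trace field).
[cite: Gordon1999HodgeAVSurvey, §3 Theorem (proof), 7.5–7.7 and 7.6.1] [cite: Lang2002, VI §1 Thm. 1.1 and Cor. 1.6] -/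
theorem forall_cmFamilyRank_add_card_eq_iff_of_traces_le_of_le_fieldRange {i₀ i₁ : I} (h01 : i₀ ≠ i₁)
    (hI : ∀ l, l = i₀ ∨ l = i₁) (b₀ : K i₁ →+* ℂ)
    (hT₁ : ∀ (b : K i₁ →+* ℂ) (k : K i₁), b k ∈ normalClosure ℚ (K i₀) ℂ → b k ∈ normalClosure ℚ T ℂ)
    (hgal : normalClosure ℚ T ℂ ≤ b₀.toRatAlgHom.fieldRange) :
    (∀ Φ : ∀ i, CMType (K i), CMAlgebra.cmFamilyRank Φ + Fintype.card I = (∑ i, cmTypeRank (Φ i)) + 1) ↔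
      ∀ (a : K i₀ →+* ℂ) (k : K i₀), a k ∈ normalClosure ℚ T ℂ → starRingEnd ℂ (a k) = a k :=
  forall_cmFamilyRank_add_card_eq_iff_of_absorbed_of_le_fieldRange h01 hI b₀
    (fun Φ => span_coeff_inf_eq_of_traces_le Φ i₀ i₁ hT₁) hgal

/-- **LEVEL THREE**: `T₁` with `b(K_{i₁}) ∩ L₀ ⊆ L_{T₁}` (all `b`), `T₂` with `a(K_{i₀}) ∩ L_{T₁} ⊆ L_{T₂}` (all `a`;
canonically `L_{T₂} = E₂`, the Galois closure of the trace `K_{i₀} ∩ E₁`), and `L_{T₂} ⊆ a₀(K_{i₀})` — e.g. that trace field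
normal over `ℚ`.  Then `Hg(A₀ × A₁) = Hg(A₀) × Hg(A₁)` for ALL CM types **iff conjugation fixes every `b(K_{i₁}) ∩ L_{T₂}`
pointwise** — iff the two fields have no common subfield with a CM type.
[cite: Gordon1999HodgeAVSurvey, §3 Theorem (proof), 7.5–7.7 and 7.6.1] [cite: MoonenZarhin1999LowDim, Thm. (0.2)]
[cite: Lang2002, VI §1 Thm. 1.1 and Cor. 1.6] -/
theorem forall_cmFamilyRank_add_card_eq_iff_of_traces_le_of_traces_le_of_le_fieldRange {i₀ i₁ : I} (h01 : i₀ ≠ i₁)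
    (hI : ∀ l, l = i₀ ∨ l = i₁) (a₀ : K i₀ →+* ℂ)
    (hT₁ : ∀ (b : K i₁ →+* ℂ) (k : K i₁), b k ∈ normalClosure ℚ (K i₀) ℂ → b k ∈ normalClosure ℚ T ℂ)
    (hT₂ : ∀ (a : K i₀ →+* ℂ) (k : K i₀), a k ∈ normalClosure ℚ T ℂ → a k ∈ normalClosure ℚ T' ℂ)
    (hgal : normalClosure ℚ T' ℂ ≤ a₀.toRatAlgHom.fieldRange) :
    (∀ Φ : ∀ i, CMType (K i), CMAlgebra.cmFamilyRank Φ + Fintype.card I = (∑ i, cmTypeRank (Φ i)) + 1) ↔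
      ∀ (b : K i₁ →+* ℂ) (k : K i₁), b k ∈ normalClosure ℚ T' ℂ → starRingEnd ℂ (b k) = b k :=
  forall_cmFamilyRank_add_card_eq_iff_of_absorbed_of_le_fieldRange' h01 hI a₀
    (fun Φ => span_coeff_inf_eq_of_traces_le_of_traces_le Φ i₀ i₁ hT₁ hT₂) hgal

/-- **LEVEL THREE, NORMAL TRACE FIELD**: with `T₁` as above, if the trace field `T₂ = a₀⁻¹(L_{T₁}) ≤ K_{i₀}` is normal over
`ℚ` then `L_{T₂} = a₀(T₂) ⊆ a₀(K_{i₀})`, so additivity for all types iff conjugation fixes every `b(K_{i₁}) ∩ a₀(T₂)`.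
[cite: Gordon1999HodgeAVSurvey, §3 Theorem (proof) and 7.5–7.7] [cite: Lang2002, VI §1 Thm. 1.1] -/
theorem forall_cmFamilyRank_add_card_eq_iff_of_traces_le_of_normal_trace {i₀ i₁ : I} (h01 : i₀ ≠ i₁)
    (hI : ∀ l, l = i₀ ∨ l = i₁) (a₀ : K i₀ →+* ℂ)
    (hT₁ : ∀ (b : K i₁ →+* ℂ) (k : K i₁), b k ∈ normalClosure ℚ (K i₀) ℂ → b k ∈ normalClosure ℚ T ℂ)
    (hn : Normal ℚ ↥((normalClosure ℚ T ℂ).comap a₀.toRatAlgHom)) :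
    (∀ Φ : ∀ i, CMType (K i), CMAlgebra.cmFamilyRank Φ + Fintype.card I = (∑ i, cmTypeRank (Φ i)) + 1) ↔
      ∀ (b : K i₁ →+* ℂ) (k : K i₁),
        b k ∈ normalClosure ℚ ↥((normalClosure ℚ T ℂ).comap a₀.toRatAlgHom) ℂ → starRingEnd ℂ (b k) = b k := by
  refine forall_cmFamilyRank_add_card_eq_iff_of_traces_le_of_traces_le_of_le_fieldRange h01 hI a₀ hT₁
    (fun a k hk => apply_mem_normalClosure_comap_of_mem (T := T) a₀ a k hk) ?_
  rw [normalClosure_eq_fieldRange_of_normal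
    (a₀.toRatAlgHom.comp ((normalClosure ℚ T ℂ).comap a₀.toRatAlgHom).val)]
  rintro _ ⟨k, rfl⟩
  exact ⟨(k : K i₀), rfl⟩

end Summit.HodgeConjecture.CorCM

end
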